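import Mathlib
import Summits.Ventures.PercRepro2.Defs
import Summits.Ventures.PercRepro2.Graph
import Summits.Ventures.PercRepro2.Events
import Summits.Ventures.PercRepro2.Independence
import Summits.Ventures.PercRepro2.Harris
import Summits.Ventures.PercRepro2.RowC1PendZ
import Summits.Ventures.PercRepro2.RowC1PendZSym

/-!
# The covariance form of the symmetric candidate `(C3)` (blind cell PercRepro2, p2 g37)

On `G − a₁` with root `a₂`, attachment vertex `v` and marks `o`, `b` write `F = {v ↔ a₂}`,
`O = {o ↔ a₂}`, `B = {b ↔ a₂}`, `R_x = Fᶜ ∩ {v ↔ x}`, `p = P(Fᶜ)`, `q = P(F)`, and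
`ρ_x = P(R_x)`.  The symmetric quantity of RowC1PendZSym.lean is
`zsym = p · Cov(O,B) + q · ρ_o · ρ_b − Cov(O,F) · ρ_b − Cov(B,F) · ρ_o`.

This file records the **covariance form**: with the *residual observable* of a mark `x`

  `X_x := p · 1_{x ↔ a₂} − ρ_x · 1_{v ↔ a₂}`   (`resid`)

one has, as an identity of expectations (no division anywhere),

  `p · zsym = Cov(X_o, X_b) = E[X_o X_b] − E[X_o] · E[X_b]`   (`prob_compl_mul_zsym_eq_cov`),

because `Cov(X_o, X_b) = p² Cov(O,B) − p ρ_b Cov(O,F) − p ρ_o Cov(B,F) + ρ_o ρ_b Var(F)` and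
`Var(F) = p q`.  Consequences:

* `(C3)` (`zsym ≥ 0`) is **equivalent** to the positive correlation of the residuals
  (`zsym_nonneg_iff_cov_nonneg`), i.e. to the pairwise positive association of the family
  `{X_x}_{x ∈ V}`;
* for `o = b` the covariance is a variance, so **`zsym p ends v a₂ o o ≥ 0`** (`zsym_self_nonneg`);
  this is the kernel form of the shared-cluster closed form of proofs/P2-G36-SYM.md §3(c)
  (there `O = B` and `R_o = R_b`, so `zsym(P_h) = p_h · Var(X)`);
* the degenerate marks: `o = a₂` gives `zsym = 0` (`zsym_root_eq_zero`) and `o = v` gives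
  `zsym = 0` (`zsym_attach_eq_zero`).

Std axioms.
-/

namespace Summit.Ventures.PercRepro2

namespace RowC1

section PendZCov

variable {V : Type*} {E : Type*} [Fintype E] [DecidableEq E] [Fintype V] [DecidableEq V]
  {R : Type*} [Field R] [LinearOrder R] [IsStrictOrderedRing R]

omit [Fintype V] [DecidableEq V] [LinearOrder R] [IsStrictOrderedRing R] in
/-- Expectation of a product of two affine combinations of indicators, in terms of the
probabilities of the pairwise intersections. -/
lemma zc_expect_prod (p : E → R) (A B F : Set (Config E)) (c₁ c₂ d₁ d₂ : R) :
    expect p (fun ω => (c₁ * A.indicator 1 ω - c₂ * F.indicator 1 ω) *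
        (d₁ * B.indicator 1 ω - d₂ * F.indicator 1 ω)) =
      c₁ * d₁ * prob p (A ∩ B) - c₁ * d₂ * prob p (A ∩ F) - c₂ * d₁ * prob p (B ∩ F) +
        c₂ * d₂ * prob p F := by
  simp only [prob, expect, Finset.mul_sum, ← Finset.sum_sub_distrib, ← Finset.sum_add_distrib]
  refine Finset.sum_congr rfl fun ω _ => ?_
  by_cases hA : ω ∈ A <;> by_cases hB : ω ∈ B <;> by_cases hF : ω ∈ F <;>
    simp [hA, hB, hF] <;> ring

omit [Fintype V] [DecidableEq V] [LinearOrder R] [IsStrictOrderedRing R] in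
/-- Expectation of an affine combination of two indicators. -/
lemma zc_expect_lin (p : E → R) (A F : Set (Config E)) (c₁ c₂ : R) :
    expect p (fun ω => c₁ * A.indicator 1 ω - c₂ * F.indicator 1 ω) =
      c₁ * prob p A - c₂ * prob p F := by
  simp only [prob, expect, Finset.mul_sum, ← Finset.sum_sub_distrib]
  refine Finset.sum_congr rfl fun ω _ => ?_
  by_cases hA : ω ∈ A <;> by_cases hF : ω ∈ F <;> simp [hA, hF] <;> ring

omit [Fintype V] [DecidableEq V] in
/-- The variance of an observable is nonnegative: `E[f²] − (E f)² ≥ 0`. -/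
lemma zc_var_nonneg {p : E → R} (hp : IsProbVec p) (f : Config E → R) :
    0 ≤ expect p (fun ω => f ω * f ω) - expect p f * expect p f := by
  have hsq : 0 ≤ expect p (fun ω => (f ω - expect p f) * (f ω - expect p f)) :=
    expect_nonneg hp fun ω => mul_self_nonneg _
  have hexp : expect p (fun ω => (f ω - expect p f) * (f ω - expect p f)) =
      expect p (fun ω => f ω * f ω) - expect p f * expect p f := by
    have h1 := sum_weight p
    simp only [expect]
    have hpt : ∑ ω, weight p ω * ((f ω - ∑ ω', weight p ω' * f ω') *
        (f ω - ∑ ω', weight p ω' * f ω')) =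
        ∑ ω, (weight p ω * (f ω * f ω) -
          (2 * ∑ ω', weight p ω' * f ω') * (weight p ω * f ω) +
          ((∑ ω', weight p ω' * f ω') * (∑ ω', weight p ω' * f ω')) * weight p ω) :=
      Finset.sum_congr rfl fun ω _ => by ring
    rw [hpt, Finset.sum_add_distrib, Finset.sum_sub_distrib, ← Finset.mul_sum, ← Finset.mul_sum,
      h1]
    ring
  linarith

/-- The **residual observable** of a mark `x`: `p · 1_{x ↔ a₂} − ρ_x · 1_{v ↔ a₂}`, with
`p = P(Fᶜ)`, `F = {v ↔ a₂}`, `ρ_x = P(Fᶜ ∩ {v ↔ x})`. -/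
noncomputable def resid (p : E → R) (ends : E → Sym2 V) (v a₂ x : V) : Config E → R :=
  fun ω => prob p (connEvent ends a₂ v)ᶜ * (connEvent ends a₂ x).indicator 1 ω -
    prob p ((connEvent ends a₂ v)ᶜ ∩ connEvent ends v x) * (connEvent ends a₂ v).indicator 1 ω

omit [Fintype V] [DecidableEq V] [LinearOrder R] [IsStrictOrderedRing R] in
/-- **The covariance form**: `P(Fᶜ) · zsym = E[X_o X_b] − E[X_o] · E[X_b]` for the residual
observables `X_x = resid p ends v a₂ x` — an identity of expectations (only `P(Fᶜ) = 1 − P(F)`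
is used). -/
theorem prob_compl_mul_zsym_eq_cov (p : E → R) (ends : E → Sym2 V) (v a₂ o b : V) :
    prob p (connEvent ends a₂ v)ᶜ * zsym p ends v a₂ o b =
      expect p (fun ω => resid p ends v a₂ o ω * resid p ends v a₂ b ω) -
        expect p (resid p ends v a₂ o) * expect p (resid p ends v a₂ b) := by
  unfold resid
  rw [zc_expect_prod, zc_expect_lin, zc_expect_lin]
  have hF := prob_compl p (connEvent ends a₂ v)
  unfold zsym
  rw [hF]
  ring

omit [Fintype V] [DecidableEq V] in
/-- If `P(Fᶜ) = 0` then `zsym = 0` (every term carries a factor `P(Fᶜ)` or `P(R_x) ≤ P(Fᶜ)`). -/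
lemma zsym_eq_zero_of_prob_compl_eq_zero (p : E → R) (hp : IsProbVec p) (ends : E → Sym2 V)
    (v a₂ o b : V) (h : prob p (connEvent ends a₂ v)ᶜ = 0) : zsym p ends v a₂ o b = 0 := by
  have ho : prob p ((connEvent ends a₂ v)ᶜ ∩ connEvent ends v o) = 0 :=
    le_antisymm (h ▸ prob_mono hp Set.inter_subset_left) (prob_nonneg hp _)
  have hb : prob p ((connEvent ends a₂ v)ᶜ ∩ connEvent ends v b) = 0 :=
    le_antisymm (h ▸ prob_mono hp Set.inter_subset_left) (prob_nonneg hp _)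
  unfold zsym
  rw [h, ho, hb]
  ring

omit [Fintype V] [DecidableEq V] in
/-- **`(C3)` is the positive correlation of the residuals**: `0 ≤ zsym` iff
`0 ≤ Cov(X_o, X_b)`. -/
theorem zsym_nonneg_iff_cov_nonneg (p : E → R) (hp : IsProbVec p) (ends : E → Sym2 V)
    (v a₂ o b : V) :
    0 ≤ zsym p ends v a₂ o b ↔
      0 ≤ expect p (fun ω => resid p ends v a₂ o ω * resid p ends v a₂ b ω) -
        expect p (resid p ends v a₂ o) * expect p (resid p ends v a₂ b) := by
  rw [← prob_compl_mul_zsym_eq_cov]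
  have hpc : 0 ≤ prob p (connEvent ends a₂ v)ᶜ := prob_nonneg hp _
  rcases hpc.lt_or_eq with hlt | heq
  · exact ⟨fun h => mul_nonneg hpc h, fun h => nonneg_of_mul_nonneg_right h hlt⟩
  · rw [← heq, zero_mul]
    rw [zsym_eq_zero_of_prob_compl_eq_zero p hp ends v a₂ o b heq.symm]

omit [Fintype V] [DecidableEq V] in
/-- **`zsym ≥ 0` for `o = b`**: the covariance form is then a variance.  This is the kernel
form of the shared-cluster closed form of proofs/P2-G36-SYM.md §3(c). -/
theorem zsym_self_nonneg (p : E → R) (hp : IsProbVec p) (ends : E → Sym2 V) (v a₂ o : V) :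
    0 ≤ zsym p ends v a₂ o o :=
  (zsym_nonneg_iff_cov_nonneg p hp ends v a₂ o o).2 (zc_var_nonneg hp _)

omit [Fintype E] [DecidableEq E] [Fintype V] [DecidableEq V] in
/-- `{a ↔ a}` is the sure event. -/
lemma connEvent_self_eq_univ (ends : E → Sym2 V) (a : V) : connEvent ends a a = Set.univ :=
  Set.eq_univ_of_forall fun ω => conn_refl ends ω a

omit [Fintype V] [DecidableEq V] [LinearOrder R] [IsStrictOrderedRing R] in
/-- The degenerate mark `o = a₂`: `zsym = 0`. -/
theorem zsym_root_eq_zero (p : E → R) (ends : E → Sym2 V) (v a₂ b : V) :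
    zsym p ends v a₂ a₂ b = 0 := by
  unfold zsym
  rw [connEvent_self_eq_univ, connEvent_comm ends v a₂, Set.compl_inter_self, Set.univ_inter,
    Set.univ_inter, prob_univ, prob_empty]
  ring

omit [Fintype V] [DecidableEq V] [LinearOrder R] [IsStrictOrderedRing R] in
/-- The degenerate mark `o = v`: `zsym = 0`. -/
theorem zsym_attach_eq_zero (p : E → R) (ends : E → Sym2 V) (v a₂ b : V) :
    zsym p ends v a₂ v b = 0 := by
  unfold zsym
  rw [connEvent_self_eq_univ, Set.inter_univ, Set.inter_self,
    Set.inter_comm (connEvent ends a₂ v) (connEvent ends a₂ b), prob_compl]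
  ring

end PendZCov

end RowC1

end Summit.Ventures.PercRepro2
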